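import Summits.QuantumFields.GaugeBoot.ClassBSiteWordBlocks
import HarnessLib

/-!
# Half-words of the diagonal and site mirrors on `ℤ^d`: decidable criteria for the Class-B
`R_diag` / `R_site` word blocks (gauge-boot, task L3(α), 4b/4)

HONEST FRAMING (cell `pub-gaugeboot`, page 1 of every file): the venture produces certified bounds
on lattice expectations at stated coupling, gauge group, dimension and torus size; NOT a mass gap,
NOT a continuum limit, NOT a string tension; NOT Yang–Mills-summit-bearing (barriers
`FixedCouplingUltralocality`, `PerturbativeInvisibility`). Bookkeeping for the Class-B column
(SCOPING A18); certifies no number.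

`ClassBDiagonalWordBlocks.lean` / `ClassBSiteWordBlocks.lean` prove that the `R_diag` / `R_site`
blocks of a Class-B state, indexed by half-words `O_a : p → q` between mirror sites and with
glued-loop entries, are PSD, taking the half-word property at the holonomy level
(`DependsOn (U ↦ hol_p(O_a)(U)) (…HalfEdges)`). Here that hypothesis is discharged from integer
geometry, `decide`-ably on concrete words (the `ℤ^d` analogue of lean1's torus-side
`Word.siteHalfOK` / `Word.linkHalfOK`):

* `Word.zdDiagHalfOK i j w y` (Boolean): read from the integer site `y`, every link traversed by `w`
  lies in `{x_i ≥ x_j}` — source `x` with `x_j ≤ x_i`, and `x_j + 1 ≤ x_i` for a link in direction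
  `j` (the condition of `diagHalfEdges i j`); `Word.zdSiteHalfOK i w y`: every link has its source
  in `{x_i ≥ 0}` (`siteHalfEdges i`);
* `dependsOn_wordHolonomyZd_of_zdDiagHalfOK` / `…_of_zdSiteHalfOK` — soundness;
* `ClassBState.rDiagWordBlock_nonneg_of_zdDiagHalfOK` / `ClassBState.rSiteWordBlock_nonneg_of_zdSiteHalfOK`
  — the block theorems with the Boolean hypotheses; `Word.zdDiagHalfOK_halfPlaquette` — the half
  plaquette `[+e_i, +e_j]` at a mirror site qualifies (`i ≠ j`).
-/

open MeasureTheory Complex Finset Function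
open scoped ComplexOrder

namespace Summit.QuantumFields.GaugeBoot

open Literature.MathematicalPhysics.QuantumFieldTheory
open Literature.MathematicalPhysics.QuantumLattice
open Literature.RepresentationTheory.CompactGroups

noncomputable section

/-! ## The criteria (integer geometry, decidable) -/

namespace Word

variable {d : ℕ}

/-- Read from the integer site `y`, every link traversed by `w` lies in the closed diagonal half
`{x_i ≥ x_j}`: the link `(x, k)` needs `x_j ≤ x_i`, and `x_j + 1 ≤ x_i` if `k = j` (the condition of
`diagHalfEdges i j`, spelled out for `decide`). -/
def zdDiagHalfOK (i j : Fin d) : Word d → (Fin d → ℤ) → Bool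
  | [], _ => true
  | s :: w, y => decide ((s.edgeZd y).1 j ≤ (s.edgeZd y).1 i ∧
      ((s.edgeZd y).2 = j → (s.edgeZd y).1 j + 1 ≤ (s.edgeZd y).1 i)) && zdDiagHalfOK i j w (s.applyZd y)

/-- Read from the integer site `y`, every link traversed by `w` has its source in the closed half
`{x_i ≥ 0}` of the site mirror `x_i = 0` (the condition of `siteHalfEdges i`). -/
def zdSiteHalfOK (i : Fin d) : Word d → (Fin d → ℤ) → Bool
  | [], _ => true
  | s :: w, y => decide (0 ≤ (s.edgeZd y).1 i) && zdSiteHalfOK i w (s.applyZd y)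

/-- Unfolding on a non-empty word (diagonal). -/
theorem zdDiagHalfOK_cons {i j : Fin d} {s : Step d} {w : Word d} {y : Fin d → ℤ}
    (h : zdDiagHalfOK i j (s :: w) y = true) :
    s.edgeZd y ∈ diagHalfEdges i j ∧ zdDiagHalfOK i j w (s.applyZd y) = true := by
  simp only [zdDiagHalfOK, Bool.and_eq_true, decide_eq_true_eq] at h
  exact ⟨h.1, h.2⟩

/-- Unfolding on a non-empty word (site). -/
theorem zdSiteHalfOK_cons {i : Fin d} {s : Step d} {w : Word d} {y : Fin d → ℤ}
    (h : zdSiteHalfOK i (s :: w) y = true) :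
    s.edgeZd y ∈ siteHalfEdges i ∧ zdSiteHalfOK i w (s.applyZd y) = true := by
  simp only [zdSiteHalfOK, Bool.and_eq_true, decide_eq_true_eq] at h
  exact ⟨h.1, h.2⟩

/-- **The half plaquette qualifies**: the word `[+e_i, +e_j]` read from a mirror site `y`
(`y_i = y_j`, `i ≠ j`) lies in the closed half `{x_i ≥ x_j}`. -/
theorem zdDiagHalfOK_halfPlaquette {i j : Fin d} (hij : i ≠ j) {y : Fin d → ℤ} (hy : y i = y j) :
    zdDiagHalfOK i j [Step.fwd i, Step.fwd j] y = true := by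
  simp [zdDiagHalfOK, Step.edgeZd, Step.applyZd, hy, hij]

/-- The three-link half of the `2 × 1` rectangle, `[+e_i, +e_k, -e_i]` read from a mirror site
`y` (`y_i = 0`, `k ≠ i`), lies in the closed half `{x_i ≥ 0}` (its glued loop is the site-symmetric
`2 × 1` rectangle `[-1, 1] × [0, 1]` in the `(i, k)` plane). -/
theorem zdSiteHalfOK_halfRectangle {i k : Fin d} (hki : k ≠ i) {y : Fin d → ℤ} (hy : y i = 0) :
    zdSiteHalfOK i [Step.fwd i, Step.fwd k, Step.bwd i] y = true := by
  simp [zdSiteHalfOK, Step.edgeZd, Step.applyZd, hy, hki]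

end Word

/-! ## Soundness -/

section Sound

variable {d : ℕ} {G : Type*} [Group G]

/-- **Support bookkeeping (diagonal)**: a `zdDiagHalfOK` word's holonomy depends only on the links
of the closed diagonal half `diagHalfEdges i j`. -/
theorem dependsOn_wordHolonomyZd_of_zdDiagHalfOK {i j : Fin d} :
    ∀ (w : Word d) (y : Fin d → ℤ), Word.zdDiagHalfOK i j w y = true →
      DependsOn (fun U : LGConfig d G => wordHolonomyZd U y w) (diagHalfEdges i j)
  | [], y, _ => fun U V _ => by simp
  | s :: w, y, h => fun U V hUV => by
    obtain ⟨hs, hw⟩ := Word.zdDiagHalfOK_cons h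
    have ih : wordHolonomyZd U (s.applyZd y) w = wordHolonomyZd V (s.applyZd y) w :=
      dependsOn_wordHolonomyZd_of_zdDiagHalfOK w (s.applyZd y) hw hUV
    simp only [wordHolonomyZd_cons, stepHolonomyZd_congr y s (hUV _ hs), ih]

/-- **Support bookkeeping (site)**: a `zdSiteHalfOK` word's holonomy depends only on the links of
the closed half `siteHalfEdges i`. -/
theorem dependsOn_wordHolonomyZd_of_zdSiteHalfOK {i : Fin d} :
    ∀ (w : Word d) (y : Fin d → ℤ), Word.zdSiteHalfOK i w y = true →
      DependsOn (fun U : LGConfig d G => wordHolonomyZd U y w) (siteHalfEdges i)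
  | [], y, _ => fun U V _ => by simp
  | s :: w, y, h => fun U V hUV => by
    obtain ⟨hs, hw⟩ := Word.zdSiteHalfOK_cons h
    have ih : wordHolonomyZd U (s.applyZd y) w = wordHolonomyZd V (s.applyZd y) w :=
      dependsOn_wordHolonomyZd_of_zdSiteHalfOK w (s.applyZd y) hw hUV
    simp only [wordHolonomyZd_cons, stepHolonomyZd_congr y s (hUV _ hs), ih]

end Sound

/-! ## The Class-B blocks with the Boolean hypotheses -/

section ClassB

variable {d N : ℕ} {G : Type*} [Group G] [TopologicalSpace G] [IsTopologicalGroup G]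
  [CompactSpace G] [MeasurableSpace G] [BorelSpace G] (ρ : G →* Matrix (Fin N) (Fin N) ℂ)

/-- ★★★ **Class-B `R_diag` blocks with loop-variable entries, decidable hypotheses.** For a Class-B
state `ω`, continuous `ρ`, `i ≠ j`, mirror sites `p, q` (`p_i = p_j`, `q_i = q_j`), words
`O_a : p → q` with `Word.zdDiagHalfOK i j (O a) p` and real `c`:
`0 ≤ Σ_{ab} c_a c_b ∫ W_p(O_b ++ ((i j)·O_a)⁻¹) dω.μ`. -/
theorem ClassBState.rDiagWordBlock_nonneg_of_zdDiagHalfOK {β : ℝ} (ω : ClassBState d ρ β)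
    (hρ : Continuous ρ) {i j : Fin d} (hij : i ≠ j) {p q : Fin d → ℤ} (hp : p i = p j)
    (hq : q i = q j) {n : ℕ} (O : Fin n → Word d) (hend : ∀ a, Word.endpointZd p (O a) = q)
    (hhalf : ∀ a, Word.zdDiagHalfOK i j (O a) p = true) (c : Fin n → ℝ) :
    0 ≤ ∑ a, ∑ b, c a * c b * ∫ U, wordLoopZd ρ p
      (O b ++ Word.reverse ((O a).map (Step.permute (Equiv.swap i j)))) U ∂ω.μ :=
  ω.rDiagWordBlock_nonneg ρ hρ hij hp hq O hend
    (fun a => dependsOn_wordHolonomyZd_of_zdDiagHalfOK (O a) p (hhalf a)) c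

/-- ★★★ **Class-B `R_site` blocks with loop-variable entries, decidable hypotheses.** For a Class-B
state `ω`, continuous `ρ`, axis `i` (`Θ_i` measurable), mirror sites `p, q` (`p_i = q_i = 0`), words
`O_a : p → q` with `Word.zdSiteHalfOK i (O a) p` and real `c`:
`0 ≤ Σ_{ab} c_a c_b ∫ W_p(O_b ++ (flip_i O_a)⁻¹) dω.μ`. -/
theorem ClassBState.rSiteWordBlock_nonneg_of_zdSiteHalfOK {β : ℝ} (ω : ClassBState d ρ β)
    (hρ : Continuous ρ) {i : Fin d}
    (hΘ : Measurable (configSiteReflect (G := G) i : LGConfig d G → LGConfig d G))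
    {p q : Fin d → ℤ} (hp : p i = 0) (hq : q i = 0) {n : ℕ} (O : Fin n → Word d)
    (hend : ∀ a, Word.endpointZd p (O a) = q) (hhalf : ∀ a, Word.zdSiteHalfOK i (O a) p = true)
    (c : Fin n → ℝ) :
    0 ≤ ∑ a, ∑ b, c a * c b * ∫ U, wordLoopZd ρ p
      (O b ++ Word.reverse ((O a).map (Step.flipAt i))) U ∂ω.μ :=
  ω.rSiteWordBlock_nonneg ρ hρ hΘ hp hq O hend
    (fun a => dependsOn_wordHolonomyZd_of_zdSiteHalfOK (O a) p (hhalf a)) c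

end ClassB

end

end Summit.QuantumFields.GaugeBoot
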